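import Summits.BirchSwinnertonDyer.BirchSwinnertonDyer.Theorems.EisensteinPrimesResidualLineRigidity
import Summits.BirchSwinnertonDyer.BirchSwinnertonDyer.Theorems.EisensteinPrimesGoodLatticeMuLambdaSplit
import Literature.NumberTheory.GaloisRepresentations.TeichmullerCharacter
import HarnessLib

/-!
# Every residual pair over `K` of `E[p]` (`E/ℚ`) is the restriction of the Teichmüller pair over `ℚ`
# (helper file for crux 2 `GoodLatticeBDPValue`, stmt-BirchSwinnertonDyer-19032, line `halves`;
# seat `bsd-line-x1-p1-w2` gen 2 — the K-to-ℚ bridge for the residual-pair binders, part 2 of 2)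

WHY. The line's stubs (`stub_anDS`, `stub_imprim`) and idea-11's AN split are typed with a K-LEVEL
residual pair `IsResidualPairOver (W.baseChange K) p θsub θquot`, while the Hecke-side facts (finite
order, `c`-invariance, unramified at `p`) are in the tree only for characters RESTRICTED FROM `ℚ`.

* §3 `IsTeichmullerLiftOnQuot.eq_of_exists_notMem`: two Teichmüller lifts of the action on the same
  cyclic subquotient `T/N` (with a witness `P₀ ∈ T ∖ N`, `p • P₀ ∈ N`) coincide — the lifting integers
  are congruent mod `p`, so the entries, `(p−1)`-th roots of unity, are congruent modulo `𝔪`, hence equal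
  (`GaloisRepresentations.eq_of_pow_eq_one_of_norm_sub_lt_one`).
* §4 `residualPair_eq_restrictField`: under `2 ≠ p`, `Anom`, no unramified rational `p`-line, `K`
  imaginary quadratic: every residual pair over `K` equals `(ω̃|_{Γ_K}, 𝟙̃|_{Γ_K})` for the Teichmüller
  pair `(ω̃, 𝟙̃)` of a rational `p`-line (part 1's `isRationalLine_of_forall_restrict_smul_mem` +
  `isRationalLine_unique` on the pulled-back line, transport `RatClosure.pointsEquiv`, §3).

Pure Galois-module bookkeeping on constructed objects; no definition, no named fact, no `sorry`;
nothing about BSD. `lint.theses-cone` advisory: `…GoodLatticeMuLambdaSplit` (for `RatClosure` transport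
lemmas `isTeichmullerLiftOnQuot_restrictField`, `map_pointsEquiv_geomTorsion`, `exists_mem_geomTorsion_notMem`)
lies in the route cone — disclosed. References: Keller–Yin 2024 §1.4; Serre, Local Fields II §4 Prop. 8.
-/

-- the summit namespace `Summit.BirchSwinnertonDyer.BirchSwinnertonDyer` repeats the problem name by design (D-0017)
set_option linter.dupNamespace false
set_option autoImplicit false

noncomputable section

open scoped Classical

open WeierstrassCurve NumberField IsDedekindDomain Field
  Literature.NumberTheory.EllipticCurves Literature.NumberTheory.EllipticCurves.Rank1Residual
  Literature.NumberTheory.GaloisRepresentations Literature.NumberTheory.EllipticCurves.KellerYin2024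
  Summit.BirchSwinnertonDyer.BirchSwinnertonDyer.Theorems.EisensteinPrimesMuLambda

namespace Summit.BirchSwinnertonDyer.BirchSwinnertonDyer.Theorems.ResidualLineRigidity

/-! ## §3 Teichmüller lifts on a cyclic subquotient are unique -/

section Teichmuller

variable {K : Type} [Field K] {p : ℕ} [Fact p.Prime] {S : Set (PadicAlgCl p)}
  {M : Type*} [AddCommGroup M] [DistribMulAction (absoluteGaloisGroup K) M]

/-- Entries of powers of `1 × 1` matrices. [folklore] -/
private theorem matrix_fin_one_pow_apply {R : Type*} [CommRing R] (A : Matrix (Fin 1) (Fin 1) R)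
    (k : ℕ) : (A ^ k) 0 0 = A 0 0 ^ k := by
  induction k with
  | zero => simp
  | succ k ih => rw [pow_succ, Matrix.mul_apply, Fin.sum_univ_one, ih, pow_succ]

/-- The entry of a `(p−1)`-torsion rank-one representation is a `(p−1)`-th root of unity in `ℚ̄_p`.
[cite: KellerYin2024, §1.1 (arXiv:2402.12781v2 TeX L441)] -/
theorem entry_pow_eq_one {θ : FramedGaloisRep K (padicCoeffIntegers S) 1}
    (hθ : ∀ σ : absoluteGaloisGroup K, θ σ ^ (p - 1) = 1) (σ : absoluteGaloisGroup K) :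
    ((entry S θ σ : padicCoeffIntegers S) : PadicAlgCl p) ^ (p - 1) = 1 := by
  have h := congrArg (fun g : GL (Fin 1) (padicCoeffIntegers S) ↦
    (((g : Matrix (Fin 1) (Fin 1) (padicCoeffIntegers S)) 0 0 : padicCoeffIntegers S) : PadicAlgCl p))
    (hθ σ)
  simp only [Units.val_pow_eq_pow_val, matrix_fin_one_pow_apply, Units.val_one, Matrix.one_apply_eq,
    SubmonoidClass.coe_pow, OneMemClass.coe_one] at h
  exact h

/-- If `a • P ∈ N` for all `P ∈ T` and some `P₀ ∈ T` is not in `N` while `p • P₀ ∈ N`, then `p ∣ a`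
(Bézout). [folklore] -/
theorem dvd_of_forall_zsmul_mem {N T : AddSubgroup M} {a : ℤ} (ha : ∀ P ∈ T, a • P ∈ N)
    {P₀ : M} (hP₀ : P₀ ∈ T) (hP₀N : P₀ ∉ N) (hp₀ : (p : ℤ) • P₀ ∈ N) : (p : ℤ) ∣ a := by
  by_contra h
  have hprime : Prime (p : ℤ) := Nat.prime_iff_prime_int.mp Fact.out
  have hcop : IsCoprime (p : ℤ) a := (Irreducible.coprime_iff_not_dvd hprime.irreducible).mpr h
  obtain ⟨x, y, hxy⟩ := hcop
  apply hP₀N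
  have : P₀ = x • ((p : ℤ) • P₀) + y • (a • P₀) := by
    rw [smul_smul, smul_smul, ← add_smul, hxy, one_smul]
  rw [this]
  exact N.add_mem (N.zsmul_mem hp₀ x) (N.zsmul_mem (ha P₀ hP₀) y)

/-- **Two Teichmüller lifts of the action on the same cyclic subquotient `T/N` of exponent `p` coincide**,
granted a witness `P₀ ∈ T ∖ N` with `p • P₀ ∈ N`: the two lifting integers are congruent mod `p`, so
the two entries — `(p−1)`-th roots of unity — are congruent modulo `𝔪`, hence equal
(`GaloisRepresentations.eq_of_pow_eq_one_of_norm_sub_lt_one`).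
[cite: KellerYin2024, §1.4 (arXiv:2402.12781v2 TeX L1063–1086) and §1.1 (L441)] [cite: SerreLocalFields1979, Ch. II §4 Prop. 8] -/
theorem IsTeichmullerLiftOnQuot.eq_of_exists_notMem {N T : AddSubgroup M}
    {θ θ' : FramedGaloisRep K (padicCoeffIntegers S) 1} (hθ : IsTeichmullerLiftOnQuot S N T θ)
    (hθ' : IsTeichmullerLiftOnQuot S N T θ') {P₀ : M} (hP₀ : P₀ ∈ T) (hP₀N : P₀ ∉ N)
    (hp₀ : (p : ℤ) • P₀ ∈ N) : θ = θ' := by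
  have hp : p.Prime := Fact.out
  refine ContinuousMonoidHom.ext fun σ ↦ ?_
  obtain ⟨a, ha, haN⟩ := hθ.2 σ
  obtain ⟨a', ha', haN'⟩ := hθ'.2 σ
  -- `p ∣ a - a'`
  have hdvd : (p : ℤ) ∣ a - a' := by
    refine dvd_of_forall_zsmul_mem (fun P hP ↦ ?_) hP₀ hP₀N hp₀
    have h := N.sub_mem (haN' P hP) (haN P hP)
    rwa [sub_sub_sub_cancel_left, ← sub_smul] at h
  -- hence `‖a - a'‖ < 1` in `ℚ̄_p`
  have hnorm : ‖((a : PadicAlgCl p)) - (a' : PadicAlgCl p)‖ < 1 := by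
    obtain ⟨t, ht⟩ := hdvd
    have e : ((a : PadicAlgCl p)) - (a' : PadicAlgCl p) = ((a - a' : ℤ) : ℚ_[p]) := by push_cast; rfl
    rw [e, PadicAlgCl.norm_extends, ht]
    push_cast
    rw [norm_mul]
    calc ‖(p : ℚ_[p])‖ * ‖(t : ℚ_[p])‖ ≤ ‖(p : ℚ_[p])‖ * 1 :=
          mul_le_mul_of_nonneg_left (Padic.norm_int_le_one t) (norm_nonneg _)
      _ < 1 := by rw [mul_one]; exact Padic.norm_p_lt_one
  -- the entries are congruent, hence equal
  set e := ((entry S θ σ : padicCoeffIntegers S) : PadicAlgCl p) with he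
  set e' := ((entry S θ' σ : padicCoeffIntegers S) : PadicAlgCl p) with he'
  have hee' : ‖e - e'‖ < 1 := by
    have h1 : e - e' = (e - a) + (((a : PadicAlgCl p)) - a') + ((a' : PadicAlgCl p) - e') := by ring
    rw [h1]
    refine lt_of_le_of_lt (PadicAlgCl.isNonarchimedean p _ _) (max_lt ?_ ?_)
    · refine lt_of_le_of_lt (PadicAlgCl.isNonarchimedean p _ _) (max_lt ha hnorm)
    · rwa [← norm_neg, neg_sub]
  have hp2 : 2 ≤ p := hp.two_le
  have hpd : ¬ p ∣ p - 1 := fun h ↦ by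
    have := Nat.le_of_dvd (by omega) h
    omega
  have heq : e = e' := eq_of_pow_eq_one_of_norm_sub_lt_one (by omega) hpd
    (entry_pow_eq_one hθ.1 σ) (entry_pow_eq_one hθ'.1 σ) hee'
  -- equal entries ⇒ equal `1 × 1` matrices
  have hent : entry S θ σ = entry S θ' σ := Subtype.ext heq
  refine Units.ext (Matrix.ext fun i j ↦ ?_)
  rw [Subsingleton.elim i 0, Subsingleton.elim j 0]
  exact hent

end Teichmuller

/-! ## §4 The bridge: a residual pair over `K` is the restriction of the Teichmüller pair over `ℚ` -/

section Bridge

variable (W : WeierstrassCurve ℚ) [W.IsElliptic] [W.IsGloballyMinimal] (p : ℕ) [Fact p.Prime]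
  {S : Set (PadicAlgCl p)} (K : Type) [Field K] [NumberField K]

omit [W.IsElliptic] [W.IsGloballyMinimal] [NumberField K] in
/-- A subgroup of prime order `p` has a non-zero element. [folklore] -/
theorem exists_ne_zero_mem' {M : Type*} [AddCommGroup M] {Φ : AddSubgroup M} (hΦ : Nat.card Φ = p) :
    ∃ P ∈ Φ, P ≠ 0 := by
  have hp : p.Prime := Fact.out
  by_contra h
  push Not at h
  haveI : Subsingleton Φ := ⟨fun a b ↦ Subtype.ext (by rw [h a.1 a.2, h b.1 b.2])⟩
  have h1 : Nat.card Φ = 1 := Nat.card_of_subsingleton (0 : Φ)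
  rw [hΦ] at h1
  exact hp.one_lt.ne' h1

/-- **THE BRIDGE.** `E/ℚ` with a good anomalous Eisenstein prime `p > 2` and no unramified rational
`p`-line, `K` imaginary quadratic, `(Φ₀; ω̃, 𝟙̃)` a rational `p`-line with its Teichmüller pair over `ℚ`:
EVERY residual pair `(θsub, θquot)` of `E[p](K̄)` over `K` (`IsResidualPairOver (W/K) p θsub θquot`) is
`(ω̃|_{Γ_K}, 𝟙̃|_{Γ_K})`. (Its `Γ_K`-stable line, pulled back along `E(ℚ̄) ≃ E(K̄)`, is rational by §2,
hence `= Φ₀` by uniqueness; Teichmüller lifts on the resulting common subquotients are unique, §3.)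
[cite: KellerYin2024, §1.4 (arXiv:2402.12781v2 TeX L1063–1086)] [cite: SerreInventiones1972, §1.11] -/
theorem residualPair_eq_restrictField (hp2 : p ≠ 2) (hanom : Anom W p)
    (hGL : ∀ Φ : AddSubgroup (geomTorsion W (p : ℤ)), IsRationalLine W p Φ → ¬ LineUnramifiedAt W p Φ)
    (hK : IsImaginaryQuadratic K) {Φ₀ : AddSubgroup (geomTorsion W (p : ℤ))} (hΦ₀ : IsRationalLine W p Φ₀)
    {θsub₀ θquot₀ : FramedGaloisRep ℚ (padicCoeffIntegers S) 1}
    (hsub₀ : IsTeichmullerLiftOn S (Φ₀.map (geomTorsion W (p : ℤ)).subtype) θsub₀)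
    (hquot₀ : IsTeichmullerLiftOnQuot S (Φ₀.map (geomTorsion W (p : ℤ)).subtype)
      (geomTorsion W (p : ℤ)) θquot₀)
    {θsub θquot : FramedGaloisRep K (padicCoeffIntegers S) 1}
    (hpair : IsResidualPairOver (W.baseChange K) p θsub θquot) :
    θsub = θsub₀.restrictField K ∧ θquot = θquot₀.restrictField K := by
  have hp : p.Prime := Fact.out
  obtain ⟨Φ, hcard, hle, hstab, hTsub, hTquot⟩ := hpair
  set e : geomPoints W ≃+ geomPoints (W.baseChange K) := RatClosure.pointsEquiv (K := K) W with he
  -- pull the line back to `E[p](ℚ̄)`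
  set Ψ' : AddSubgroup (geomPoints W) := Φ.comap e.toAddMonoidHom with hΨ'
  have hΨ'Φ : Ψ'.map e.toAddMonoidHom = Φ :=
    AddSubgroup.map_comap_eq_self_of_surjective e.surjective Φ
  have hΨ'le : Ψ' ≤ geomTorsion W (p : ℤ) := by
    intro P hP
    have hP' : e P ∈ geomTorsion (W.baseChange K) (p : ℤ) := hle hP
    rw [mem_geomTorsion_iff] at hP' ⊢
    apply e.injective
    rw [map_zsmul, hP', map_zero]
  set Ψ : AddSubgroup (geomTorsion W (p : ℤ)) := Ψ'.addSubgroupOf (geomTorsion W (p : ℤ)) with hΨ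
  have hΨmap : Ψ.map (geomTorsion W (p : ℤ)).subtype = Ψ' := AddSubgroup.map_addSubgroupOf_eq_of_le hΨ'le
  have hΨcard : Nat.card Ψ = p := by
    rw [hΨ, Nat.card_congr (AddSubgroup.addSubgroupOfEquivOfLe hΨ'le).toEquiv,
      Nat.card_congr (e.addSubgroupMap Ψ').toEquiv]
    change Nat.card (Ψ'.map e.toAddMonoidHom) = p
    rw [hΨ'Φ, hcard]
  have hΨstab : ∀ (τ : absoluteGaloisGroup K), ∀ P ∈ Ψ, absGaloisRestrict ℚ K τ • P ∈ Ψ := by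
    intro τ P hP
    rw [hΨ, AddSubgroup.mem_addSubgroupOf] at hP ⊢
    change e ((absGaloisRestrict ℚ K τ • P : geomTorsion W (p : ℤ)) : geomPoints W) ∈ Φ
    rw [AddSubgroup.torsionBy.coe_smul, RatClosure.pointsEquiv_smul]
    exact hstab τ _ hP
  -- hence `Ψ = Φ₀` and `Φ = e(Φ₀)`
  have hΨΦ₀ : Ψ = Φ₀ :=
    isRationalLine_unique hp2 hanom hGL
      (isRationalLine_of_forall_restrict_smul_mem hp2 hanom hGL hK hΨcard hΨstab) hΦ₀
  have hΦeq : Φ = (Φ₀.map (geomTorsion W (p : ℤ)).subtype).map e.toAddMonoidHom := by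
    rw [← hΨΦ₀, hΨmap, hΨ'Φ]
  -- the ℚ-pair restricted to `K` is a residual pair on the same subquotients
  have hTquot₀ : IsTeichmullerLiftOnQuot S Φ (geomTorsion (W.baseChange K) (p : ℤ))
      (θquot₀.restrictField K) := by
    have h := isTeichmullerLiftOnQuot_restrictField W p K hquot₀
    rw [map_pointsEquiv_geomTorsion, ← he, ← hΦeq] at h
    exact h
  have hTsub₀ : IsTeichmullerLiftOn S Φ (θsub₀.restrictField K) := by
    have h := isTeichmullerLiftOnQuot_restrictField W p K hsub₀
    rw [AddSubgroup.map_bot, ← he, ← hΦeq] at h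
    exact h
  -- witnesses for the uniqueness of Teichmüller lifts
  obtain ⟨P₀, hP₀T, hP₀Φ⟩ := exists_mem_geomTorsion_notMem (W.baseChange K) (p := p) hcard
  have hp₀ : (p : ℤ) • P₀ ∈ Φ := by
    rw [(mem_geomTorsion_iff _ _ _).mp hP₀T]
    exact Φ.zero_mem
  obtain ⟨Q₀, hQ₀, hQ₀0⟩ := exists_ne_zero_mem' p hcard
  have hq₀ : (p : ℤ) • Q₀ ∈ (⊥ : AddSubgroup (geomPoints (W.baseChange K))) := by
    rw [(mem_geomTorsion_iff _ _ _).mp (hle hQ₀)]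
    exact AddSubgroup.zero_mem _
  exact ⟨IsTeichmullerLiftOnQuot.eq_of_exists_notMem hTsub hTsub₀ hQ₀
      (by rwa [AddSubgroup.mem_bot]) hq₀,
    IsTeichmullerLiftOnQuot.eq_of_exists_notMem hTquot hTquot₀ hP₀T hP₀Φ hp₀⟩

end Bridge

end Summit.BirchSwinnertonDyer.BirchSwinnertonDyer.Theorems.ResidualLineRigidity

end
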